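import Summits.AtomisticToContinuum.HydrodynamicLimit.Theorems.ImplosionDichotomyIdealGasImplosionOfTypeOne
import Summits.AtomisticToContinuum.HydrodynamicLimit.Theorems.ImplosionDichotomyTypeOneIdealImplosionHolds

/-!
# `ImplosionDichotomy.IdealGasImplosion` — closing file

Closes the support item `IdealGasImplosion` (stmt-AtomisticToContinuum-12588) of the route
`ImplosionDichotomy` (`AtomisticToContinuum/HydrodynamicLimit`): continuous positive profiles on
`𝕋³` and a classical σ = 0 (monatomic ideal gas) solution on some `[0, T₁)` with data
`(a₀/∫a₀, u₀, θ₀)` whose density is unbounded — from the now unconditional Type-I isentropic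
implosion `typeOneIdealImplosion_holds` (`…TypeOneIdealImplosionHolds`: the BCG `γ = 5/3` profile
through the 32 certified shooting windows, exact self-similar core, backward exterior, domain of
dependence, glue, rates) by `idealGasImplosion_of_typeOne` (`…IdealGasImplosionOfTypeOne`: forget
isentropy and the rate clauses except core growth, which forces unbounded density).
-/

noncomputable section

namespace Summit.AtomisticToContinuum.HydrodynamicLimit.Theorems

/-- **`IdealGasImplosion` (stmt-AtomisticToContinuum-12588), unconditionally.** Continuous
positive profiles `(a₀, u₀, θ₀)` on `𝕋³` and a classical σ = 0 solution `(ρ₁, u₁, θ₁)` on some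
`[0, T₁)`, `T₁ > 0`, with data `(a₀/∫a₀, u₀, θ₀)`, whose density is unbounded on `[0, T₁)`:
`idealGasImplosion_of_typeOne typeOneIdealImplosion_holds`.
[cite: CaolaboraEtAl2025, Thm 1.2 + Rem 1.4 + Rem 1.5] [cite: BuckmasterCaolaboraGomezserrano2025, Thm 1.1]
[cite: Majda1984, Ch. 2 Thm 2.1] -/
theorem idealGasImplosion_holds :
    Summit.AtomisticToContinuum.HydrodynamicLimit.Theses.ImplosionDichotomy.IdealGasImplosion :=
  idealGasImplosion_of_typeOne typeOneIdealImplosion_holds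

end Summit.AtomisticToContinuum.HydrodynamicLimit.Theorems

end
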